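import Literature.NumberTheory.EllipticCurves.Delbourgo1998.RankZeroLeadingTermExactPotGoodOrd
import Literature.NumberTheory.EllipticCurves.Delbourgo1998.RankZeroLeadingTermExactPotMult
import Literature.NumberTheory.EllipticCurves.BSDConductorProofs
import HarnessLib

/-!
# Delbourgo 1998, Thm. 3 + Prop. 4: the divisibility form follows from the two exact forms (proofs only)

Everything in this file is **proved**; there are no new definitions and no new named facts.

The named fact `Delbourgo1998.prop4_rankZero_pow_dvd_constantCoeff` (`RankZeroLeadingTerm.lean`;
the divisibility `p^{ord_p #Ш_E(p) + ord_p ∏_{ν≠p} c_ν} ∣ g(0) · #E(ℚ)²` for EVERY element `g` of the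
characteristic ideal of `X(E/ℚ_∞)`, on the two branches «(G)-ordinary» / «(M) `ord_p j_E < 0`» of
Delbourgo's Theorem 3 and Proposition 4 at an additive prime `p ≠ 2`) is a formal consequence of its two
EXACT siblings

* `Delbourgo1998.prop4_rankZero_constantCoeff_eq_unit_mul_of_potGoodOrd`
  (`RankZeroLeadingTermExactPotGoodOrd.lean`; (G)-ordinary branch, Prop. 4 with the printed factor
  `#H¹(ℚ_{∞,𝔭}/ℚ_p, E(ℚ_{∞,𝔭}))` kept as the order of a finite group), and
* `Delbourgo1998.prop4_rankZero_constantCoeff_eq_unit_mul_of_potMult`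
  (`RankZeroLeadingTermExactPotMult.lean`; (M) branch, Prop. 4 with that factor `= 1` by §2.2 Lemma (ii)):

a generator `g₀` of the (principal) characteristic ideal with
`g₀(0) · #E(ℚ)² = u · #Ш_E(p) · K · ∏_{ν≠p} c_ν` (`u ∈ ℤ_p^×`, `K ∈ ℕ`) gives, for `g = a · g₀`,
`g(0) · #E(ℚ)² = a(0) · u · K · (#Ш_E(p) · ∏_{ν≠p} c_ν)`, and `p^{ord_p m + ord_p n} ∣ m · n` in `ℤ_p` for
natural numbers `m, n`.  Hence `prop4_rankZero_pow_dvd_constantCoeff_of_exact` below: the consumers of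
the divisibility form (binder `hDel` of the additive rank-zero class theorems) may be fed from the two
exact forms, whose statements are the ones that were page-audited by name.

## References

* [Delbourgo1998] D. Delbourgo, *Iwasawa theory for elliptic curves at unstable primes*, Compositio
  Math. 113 (1998) 123–154, Thm. 3 (p. 143), Prop. 4 (p. 144), §2.2 Lemma (pp. 139–140).
-/

noncomputable section

open scoped Classical NumberField

open IsDedekindDomain NumberField WeierstrassCurve

namespace Literature.NumberTheory.EllipticCurves.Delbourgo1998

/-- `p ^ (ord_p m + ord_p n)` divides `m · n` in `ℤ_p`, for natural numbers `m`, `n`. [folklore] -/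
private theorem natCast_pow_padicValNat_add_dvd_mul {p : ℕ} [Fact p.Prime] (m n : ℕ) :
    (p : ℤ_[p]) ^ (padicValNat p m + padicValNat p n) ∣ (m : ℤ_[p]) * (n : ℤ_[p]) := by
  have hm : (p : ℤ_[p]) ^ padicValNat p m ∣ (m : ℤ_[p]) := by
    have h : p ^ padicValNat p m ∣ m := pow_padicValNat_dvd
    exact_mod_cast Nat.cast_dvd_cast (α := ℤ_[p]) h
  have hn : (p : ℤ_[p]) ^ padicValNat p n ∣ (n : ℤ_[p]) := by
    have h : p ^ padicValNat p n ∣ n := pow_padicValNat_dvd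
    exact_mod_cast Nat.cast_dvd_cast (α := ℤ_[p]) h
  rw [pow_add]
  exact mul_dvd_mul hm hn

/-- The algebraic core: if `g₀` generates an ideal `I` of `Λ = ℤ_p⟦T⟧` and
`g₀(0) · e = u · S · K · C` with `S K C : ℕ`, then for every `g ∈ I`,
`p ^ (ord_p S + ord_p C) ∣ g(0) · e`. [folklore] -/
private theorem pow_dvd_constantCoeff_mul_of_mem_span {p : ℕ} [Fact p.Prime]
    {I : Ideal (IwasawaAlgebra p)} {g₀ : IwasawaAlgebra p} (hI : I = Ideal.span {g₀})
    (e u : ℤ_[p]) (S K C : ℕ)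
    (h₀ : PowerSeries.constantCoeff g₀ * e = u * (S : ℤ_[p]) * (K : ℤ_[p]) * (C : ℤ_[p]))
    {g : IwasawaAlgebra p} (hg : g ∈ I) :
    (p : ℤ_[p]) ^ (padicValNat p S + padicValNat p C) ∣ PowerSeries.constantCoeff g * e := by
  rw [hI] at hg
  obtain ⟨a, rfl⟩ := Ideal.mem_span_singleton'.mp hg
  have hSC := natCast_pow_padicValNat_add_dvd_mul (p := p) S C
  have key : PowerSeries.constantCoeff (a * g₀) * e =
      (PowerSeries.constantCoeff a * u * (K : ℤ_[p])) * ((S : ℤ_[p]) * (C : ℤ_[p])) := by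
    rw [map_mul, mul_assoc, h₀]
    ring
  rw [key]
  exact Dvd.dvd.mul_left hSC _

/-- **`Delbourgo1998.prop4_rankZero_pow_dvd_constantCoeff` from its two exact siblings.**  The (G)-ordinary
branch is `prop4_rankZero_constantCoeff_eq_unit_mul_of_potGoodOrd` applied at the place of `ℚ` above
`p` (`Rat.HeightOneSpectrum.primesEquiv`), the factor `#𝒦_{ℚ_v,0}[p^∞]` (the order of a finite group)
being absorbed into the cofactor; the (M) branch is `prop4_rankZero_constantCoeff_eq_unit_mul_of_potMult`.
[cite: Delbourgo1998, Thm. 3 (p. 143) and Prop. 4 (p. 144), with §2.2 Lemma (pp. 139–140)] -/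
theorem prop4_rankZero_pow_dvd_constantCoeff_of_exact
    (hG : prop4_rankZero_constantCoeff_eq_unit_mul_of_potGoodOrd)
    (hM : prop4_rankZero_constantCoeff_eq_unit_mul_of_potMult) :
    prop4_rankZero_pow_dvd_constantCoeff := by
  intro W _ _ p _ hp2 hadd hGM hr hfin hE κ γ hκ hγ D
  rcases hGM with hGord | hj
  · -- (G)-ordinary branch: instantiate at the place above `p`
    set v₀ : HeightOneSpectrum (𝓞 ℚ) :=
      (Rat.HeightOneSpectrum.primesEquiv (R := 𝓞 ℚ)).symm ⟨p, Fact.out⟩ with hv₀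
    have hpv₀ : (p : 𝓞 ℚ) ∈ v₀.asIdeal :=
      (natCast_mem_asIdeal_iff_eq_primesEquiv_symm v₀ Fact.out).mpr hv₀
    obtain ⟨hT, -, g₀, hg₀, hspan, u, h₀⟩ := hG W p hp2 hadd hGord hr hfin hE κ γ hκ hγ v₀ hpv₀ D
    refine ⟨hT, fun g hg ↦ ?_⟩
    exact pow_dvd_constantCoeff_mul_of_mem_span hspan _ (u : ℤ_[p]) _ _ _ h₀ hg
  · -- (M) branch
    obtain ⟨hT, g₀, hg₀, hspan, u, h₀⟩ := hM W p hp2 hadd hj hr hfin hE κ γ hκ hγ D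
    refine ⟨hT, fun g hg ↦ ?_⟩
    refine pow_dvd_constantCoeff_mul_of_mem_span hspan _ (u : ℤ_[p]) _ 1 _ ?_ hg
    rw [h₀, Nat.cast_one, mul_one]

end Literature.NumberTheory.EllipticCurves.Delbourgo1998

end
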